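import Mathlib.Algebra.Order.Chebyshev
import Mathlib.MeasureTheory.Integral.Lebesgue.Add
import Mathlib.Data.ENNReal.BigOperators
import HarnessLib

/-!
# Route `ColdStartUniversality`, support item S (stmt-QuantumFields-24811), line `piwiener`:
# running suprema of squared finite sums (the multi-noise step of the vector Picard estimates)

Helper file (lead `ym-line-csu-p1`) for stub A `stub_ambientStrongExistence`.  The `L²(sup)` contraction
estimate of the vector Picard iteration differs from the tree's 1-D one
(`Literature/Analysis/FunctionSpaces/ItoProcessesProofs.lean`, `iSup_sq_le_of_integral_repr`,
`lintegral_iSup_sq_le_of_bounds`) only in that the martingale part of each coordinate is a SUM of `8·|E|`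
Itô integrals (one per driving coordinate); the scalar pathwise lemma applies with `j := Σₙ jₙ`, after which one
needs, in `ℝ≥0∞`:

* `iSup_ofReal_sq_sum_le` — `sup_{s≤t} (Σ_{k∈F} j_k(s))² ≤ #F · Σ_{k∈F} sup_{s≤t} j_k(s)²` (Cauchy–Schwarz
  `sq_sum_le_card_mul_sum_sq` under the supremum);
* `lintegral_iSup_ofReal_sq_sum_le` — integrated: `E[sup_{s≤t}(Σ_k J_k(s))²] ≤ #F · Σ_k E[sup_{s≤t} J_k(s)²]`
  (a.e.-measurability of the running suprema as hypothesis; for a.s.-continuous adapted processes it is the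
  1-D file's `aemeasurable_biSup_Iic`).

Generic (no probability structure beyond a measure); no definition, no sorry, standard axioms.
-/

set_option autoImplicit false

noncomputable section

namespace Summit.QuantumFields.YangMills.Theorems.ColdStartUniversality

open MeasureTheory Finset
open scoped NNReal ENNReal BigOperators

/-- **Supremum of a squared finite sum**: `sup_{s ≤ t} (Σ_{k∈F} j_k s)² ≤ #F · Σ_{k∈F} sup_{s ≤ t} (j_k s)²`
in `ℝ≥0∞`. [folklore] -/
theorem iSup_ofReal_sq_sum_le {ι τ : Type*} (F : Finset ι) (j : ι → τ → ℝ) (S : Set τ) :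
    ⨆ s ∈ S, ENNReal.ofReal ((∑ k ∈ F, j k s) ^ 2) ≤
      (F.card : ℝ≥0∞) * ∑ k ∈ F, ⨆ s ∈ S, ENNReal.ofReal (j k s ^ 2) := by
  refine iSup₂_le fun s hs => ?_
  calc ENNReal.ofReal ((∑ k ∈ F, j k s) ^ 2)
      ≤ ENNReal.ofReal ((F.card : ℝ) * ∑ k ∈ F, j k s ^ 2) := ENNReal.ofReal_le_ofReal sq_sum_le_card_mul_sum_sq
    _ = (F.card : ℝ≥0∞) * ∑ k ∈ F, ENNReal.ofReal (j k s ^ 2) := by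
        rw [ENNReal.ofReal_mul (by positivity), ENNReal.ofReal_natCast,
          ENNReal.ofReal_sum_of_nonneg fun k _ => sq_nonneg _]
    _ ≤ (F.card : ℝ≥0∞) * ∑ k ∈ F, ⨆ s ∈ S, ENNReal.ofReal (j k s ^ 2) := by
        gcongr with k _
        exact le_iSup₂_of_le s hs le_rfl

/-- **Integrated form**: `∫⁻ sup_{s∈S} (Σ_k J_k s ω)² ≤ #F · Σ_k ∫⁻ sup_{s∈S} (J_k s ω)²`, for running suprema
that are a.e.-measurable. [folklore] -/
theorem lintegral_iSup_ofReal_sq_sum_le {ι τ Ω : Type*} {mΩ : MeasurableSpace Ω} {μ : Measure Ω}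
    (F : Finset ι) (J : ι → τ → Ω → ℝ) (S : Set τ)
    (hmeas : ∀ k ∈ F, AEMeasurable (fun ω => ⨆ s ∈ S, ENNReal.ofReal (J k s ω ^ 2)) μ) :
    ∫⁻ ω, ⨆ s ∈ S, ENNReal.ofReal ((∑ k ∈ F, J k s ω) ^ 2) ∂μ ≤
      (F.card : ℝ≥0∞) * ∑ k ∈ F, ∫⁻ ω, ⨆ s ∈ S, ENNReal.ofReal (J k s ω ^ 2) ∂μ := by
  calc ∫⁻ ω, ⨆ s ∈ S, ENNReal.ofReal ((∑ k ∈ F, J k s ω) ^ 2) ∂μ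
      ≤ ∫⁻ ω, (F.card : ℝ≥0∞) * ∑ k ∈ F, ⨆ s ∈ S, ENNReal.ofReal (J k s ω ^ 2) ∂μ :=
        lintegral_mono fun ω => iSup_ofReal_sq_sum_le F (fun k s => J k s ω) S
    _ = (F.card : ℝ≥0∞) * ∫⁻ ω, ∑ k ∈ F, ⨆ s ∈ S, ENNReal.ofReal (J k s ω ^ 2) ∂μ := by
        have hsum : AEMeasurable (fun ω => ∑ k ∈ F, ⨆ s ∈ S, ENNReal.ofReal (J k s ω ^ 2)) μ := by
          have h := Finset.aemeasurable_sum F hmeas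
          have hfun : (∑ i ∈ F, fun ω => ⨆ s ∈ S, ENNReal.ofReal (J i s ω ^ 2)) =
              fun ω => ∑ k ∈ F, ⨆ s ∈ S, ENNReal.ofReal (J k s ω ^ 2) := by
            funext ω; simp only [Finset.sum_apply]
          rw [hfun] at h; exact h
        rw [lintegral_const_mul'' _ hsum]
    _ = (F.card : ℝ≥0∞) * ∑ k ∈ F, ∫⁻ ω, ⨆ s ∈ S, ENNReal.ofReal (J k s ω ^ 2) ∂μ := by
        rw [lintegral_finsetSum' F hmeas]

/-- The pointwise companion `(Σ_{k∈F} a_k)² ≤ #F · Σ_{k∈F} a_k²` lifted to `ENNReal.ofReal`. [folklore] -/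
theorem ofReal_sq_sum_le {ι : Type*} (F : Finset ι) (a : ι → ℝ) :
    ENNReal.ofReal ((∑ k ∈ F, a k) ^ 2) ≤ (F.card : ℝ≥0∞) * ∑ k ∈ F, ENNReal.ofReal (a k ^ 2) := by
  calc ENNReal.ofReal ((∑ k ∈ F, a k) ^ 2)
      ≤ ENNReal.ofReal ((F.card : ℝ) * ∑ k ∈ F, a k ^ 2) := ENNReal.ofReal_le_ofReal sq_sum_le_card_mul_sum_sq
    _ = (F.card : ℝ≥0∞) * ∑ k ∈ F, ENNReal.ofReal (a k ^ 2) := by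
        rw [ENNReal.ofReal_mul (by positivity), ENNReal.ofReal_natCast,
          ENNReal.ofReal_sum_of_nonneg fun k _ => sq_nonneg _]

end Summit.QuantumFields.YangMills.Theorems.ColdStartUniversality

end
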